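import Literature.AlgebraicGeometry.Frobenioids.ArithmeticFrobenioidThm64iiiBinders
import HarnessLib

/-!
# Frobenioids I, Theorem 6.4 (iii) AS TYPED from a divisor-level transport and the degree relation of (ii)
# read through the class maps `Φ_i(L_i) → Pic_Φ(A_i)` (PROOF)

Mochizuki, *The geometry of Frobenioids I: the general theory*, Kyushu J. Math. **62** (2008) 293–400, §6,
Thm. 6.4 (iii), proof p. 116 l. 8–11 ("by (ii) … the generator class at `w₁` maps to a positive rational
multiple of the generator class at `w₂`") [cite: MochizukiFrdI2008, Thm. 6.4 (iii) p.116].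

abc-iut cell, sub-DAG `plan/L1/SUBDAG-FrdI-Thm64.md`, row T64iii/L03 in print's own form — the last glue
between the two inputs that arrive at THE constructions: the DIVISOR-LEVEL isomorphism
`e : Φ₁(L₁) ⥲ Φ₂(L₂)` of Cor. 4.11 (iii) (seat abc-iut-L1-d1's θ-supply over seat abc-iut-L1-t14's `Ψ^Φ`) and
the schema's OWN hypothesis `Thm64iiDeg … deg` (Thm. 6.4 (ii) at THE realifications, seat abc-iut-w4-d086),
read on divisors through THE class maps `cl_i : Φ_i(L_i) → Pic_Φ(A_i)` (`D ↦` class of `O(D)`) whose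
`δ_{A_i}`-degree is `deg^arith_{L_i}` (Thm. 6.4 (i)) and which intertwine `e` with `picMap`
("`Ψ^rlf` arises from `Ψ′`"): these give the divisor-level degree identity `deg^arith(e D) = deg · deg^arith(D)`
of `thm64iii_of_divTransport` (`ArithmeticFrobenioidThm64iiiBinders.lean` §5, seat abc-iut-L1-d9).
Proof-only; nothing here is specific to abc.
-/

noncomputable section

namespace Literature.AlgebraicGeometry.Frobenioids

open NumberField Function EffArithDivisor

universe u v

variable {F₁ : Type} [Field F₁] [NumberField F₁] {K₁ : Type} [Field K₁] [Algebra F₁ K₁]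
variable {F₂ : Type} [Field F₂] [NumberField F₂] {K₂ : Type} [Field K₂] [Algebra F₂ K₂]
variable {Rlf₁ : Type u} [CategoryTheory.Category.{v} Rlf₁] {Rlf₂ : Type u} [CategoryTheory.Category.{v} Rlf₂]
variable (R₁ : ArithRealification (F := F₁) (K := K₁) Rlf₁) (R₂ : ArithRealification (F := F₂) (K := K₂) Rlf₂)

/-- **The divisor-level degree identity from (ii) through the class maps**: if `cl_i : Φ_i(L_i) → Pic_Φ(A_i)`
have `δ_{A_i} ∘ cl_i = deg^arith_{L_i}`, `picMap ∘ cl₁ = cl₂ ∘ e`, and `δ_{A₂} ∘ picMap = deg · δ_{A₁}` (the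
clause of `Thm64iiDeg` at `A₁`), then `deg^arith(e D) = deg · deg^arith(D)`. [cite: MochizukiFrdI2008, Thm. 6.4 (iii) p.116] -/
theorem arithDegree_map_eq_of_classMaps {L₁ : Type} [Field L₁] [NumberField L₁] {L₂ : Type} [Field L₂]
    [NumberField L₂] {P₁ P₂ : Type} [AddCommGroup P₁] [AddCommGroup P₂] (δ₁ : P₁ ≃+ ℝ) (δ₂ : P₂ ≃+ ℝ)
    (picMap : P₁ ≃+ P₂) (deg : ℝ) (hdeg : ∀ x, δ₂ (picMap x) = deg * δ₁ x)
    (e : Multiplicative (EffArithDivisor L₁) ≃* Multiplicative (EffArithDivisor L₂))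
    (cl₁ : Multiplicative (EffArithDivisor L₁) →* Multiplicative P₁)
    (cl₂ : Multiplicative (EffArithDivisor L₂) →* Multiplicative P₂)
    (hcl₁ : ∀ D, δ₁ (Multiplicative.toAdd (cl₁ (Multiplicative.ofAdd D))) = arithDegree L₁ (toArithDivisor L₁ D))
    (hcl₂ : ∀ D, δ₂ (Multiplicative.toAdd (cl₂ (Multiplicative.ofAdd D))) = arithDegree L₂ (toArithDivisor L₂ D))
    (hecl : ∀ x, picMap (Multiplicative.toAdd (cl₁ x)) = Multiplicative.toAdd (cl₂ (e x))) (D : EffArithDivisor L₁) :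
    arithDegree L₂ (toArithDivisor L₂ (Multiplicative.toAdd (e (Multiplicative.ofAdd D)))) =
      deg * arithDegree L₁ (toArithDivisor L₁ D) := by
  have h2 := hcl₂ (Multiplicative.toAdd (e (Multiplicative.ofAdd D)))
  rw [ofAdd_toAdd] at h2
  rw [← h2, ← hecl, hdeg, hcl₁]

/-- **Theorem 6.4 (iii) AS TYPED (`Thm64iii`) from the divisor-level transport `e` and THE class maps**, USING
the schema's hypothesis `Thm64iiDeg … deg`: binders = `e : Φ₁(L₁) ⥲ Φ₂(L₂)` carrying `δ_v` to a divisor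
supported at `placeMap v` (Cor. 4.11 (iii) with its `Ψ^Prime`-compatibility), Frobenius-triviality of
`A₁ = u₁ A₁'` and of `Ψ^rlf A₁`, class maps `cl_i` with `δ ∘ cl_i = deg^arith` (Thm. 6.4 (i)) and
`picMap ∘ cl₁ = cl₂ ∘ e` ("`Ψ^rlf` arises from `Ψ′`", read on divisors). [cite: MochizukiFrdI2008, Thm. 6.4 (iii) p.116] -/
theorem thm64iii_of_divClassMaps (Ψ : Rlf₁ ≌ Rlf₂)
    (picMap : ∀ A : Rlf₁, R₁.Pic A ≃+ R₂.Pic (Ψ.functor.obj A)) (deg : ℝ)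
    {U₁ : Type u} [CategoryTheory.Category.{v} U₁] {U₂ : Type u} [CategoryTheory.Category.{v} U₂]
    (u₁ : CategoryTheory.Functor U₁ Rlf₁) (u₂ : CategoryTheory.Functor U₂ Rlf₂) (Ψ' : U₁ ≌ U₂) (A₁ : U₁)
    (placeMap : Places (R₁.ops.base.obj (u₁.obj A₁)).L ≃
      Places (R₂.ops.base.obj (u₂.obj (Ψ'.functor.obj A₁))).L)
    (e : Multiplicative (EffArithDivisor (R₁.ops.base.obj (u₁.obj A₁)).L) ≃*
      Multiplicative (EffArithDivisor (R₂.ops.base.obj (u₂.obj (Ψ'.functor.obj A₁))).L))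
    (he : ∀ v : Places (R₁.ops.base.obj (u₁.obj A₁)).L,
      psupp (Multiplicative.toAdd (e (Multiplicative.ofAdd (EffArithDivisor.single _ v)))) = {placeMap v})
    (hA : R₁.ops.IsFrobeniusTrivial (u₁.obj A₁)) (hA' : R₂.ops.IsFrobeniusTrivial (Ψ.functor.obj (u₁.obj A₁)))
    (cl₁ : Multiplicative (EffArithDivisor (R₁.ops.base.obj (u₁.obj A₁)).L) →* Multiplicative (R₁.Pic (u₁.obj A₁)))
    (cl₂ : Multiplicative (EffArithDivisor (R₂.ops.base.obj (u₂.obj (Ψ'.functor.obj A₁))).L) →*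
      Multiplicative (R₂.Pic (Ψ.functor.obj (u₁.obj A₁))))
    (hcl₁ : ∀ D, R₁.δ _ hA (Multiplicative.toAdd (cl₁ (Multiplicative.ofAdd D))) = arithDegree _ (toArithDivisor _ D))
    (hcl₂ : ∀ D, R₂.δ _ hA' (Multiplicative.toAdd (cl₂ (Multiplicative.ofAdd D))) = arithDegree _ (toArithDivisor _ D))
    (hecl : ∀ x, picMap _ (Multiplicative.toAdd (cl₁ x)) = Multiplicative.toAdd (cl₂ (e x))) :
    Thm64iii R₁ R₂ Ψ picMap deg u₁ u₂ Ψ' A₁ placeMap := fun hT h1 =>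
  thm64iii_of_divTransport R₁ R₂ Ψ picMap deg u₁ u₂ Ψ' A₁ placeMap e he
    (arithDegree_map_eq_of_classMaps (R₁.δ _ hA) (R₂.δ _ hA') (picMap _) deg (hT.2 _ hA hA') e cl₁ cl₂
      hcl₁ hcl₂ hecl) hT h1

end Literature.AlgebraicGeometry.Frobenioids

end
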